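import Summits.QuantumFields.BalabanUV.T4Continuum.Support.NE3CovariantLineSumsL2
import HarnessLib

/-!
# T⁴ programme, node NE3, row E-MLw-(w4)-P · Φ2′c — THE CRUDE FRAME BOUND (d ≥ 3, k-FREE):
# `Σ_{z∈periodBox N} ‖framePot L k Y z‖² ≤ 12·D(d,L)·Σ_{x∈periodBox (L^k·N)} Σ_κ ‖Y x κ‖²`, `D = (dL)²·d·(2dL+1)^{2d}`

NE3 formalisation swarm `b2b-balaban-t4-ne3-formalise-*`, LEAF PROVER 04 (gen 4), row **Φ2′c** of the owner's F-ne3p1-g21-1 (4) (`t4-ne3-p1-g21`,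
memo `HOME/t4/b2b-balaban-t4-ne3-p1/g21/F-ne3p1-g21-1.md` §2: «Φ2′c frame bound `Σ_z|framePot L k Y z|² ≤ C_fp·dirSq Y` (d ≥ 3; leaf-04 (A) recursion + Cauchy–Schwarz)»;
INTENT HOME/CLAIMS.log ≈15:50Z).  The accumulated frame potential of this unit's file (A) (`NE3TangentFlatStructure.framePot`, p219035) is a sum over
the `k` levels of block-tree averages read at the corner of the big block at SHRINKING scales; in `d ≥ 3` the level-`m` term carries the ℓ² weight
`(L²∕L^d)^m ≤ 2^{−m}` of the `m`-fold straight average, so a weighted Cauchy–Schwarz with weights `(3∕4)^m` sums to a k-FREE constant («corner spikes are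
cheap — point capacity O(1)»; `d = 2` is log-critical and excluded).

CONTENT (all [folklore]; 0 sorry; 0 def beyond the explicit constant `Dfp`):
§1 `framePot_eq_sum` — the closed form `framePot L k Y z = Σ_{m<k} Fcoarse L ((Qcoarse L)^[m] Y) ((L^{k−1−m})•z)` of (A)'s recursion;
§2 one term: `norm_Fcoarse_le` (`‖Fcoarse L V y‖ ≤ dL·dirL1 V (box (dL) (L•y))`: `asum = dhol 1`, `norm_dhol_le`, `lnorm_le_region`), `norm_Fcoarse_sq_le`
   (Cauchy–Schwarz on the box, `NE3CovariantLineSumsL2.dirL1_box_sq_le`), `l2sq_Qcoarse_le` ∕ `l2sq_iterate_Qcoarse_le` (EXACT WEIGHT `(L²∕L^d)^m`, tiling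
   `sum_tile_shift`), the torus term bound `sum_norm_Fcoarse_iterate_sq_le` (`≤ Dfp·(L²∕L^d)^m·l2sq Y`, box multiplicity `sum_periodBox_box_le`);
§3 **`sum_norm_framePot_sq_le`** — for `3 ≤ d`, `2 ≤ L`, `1 ≤ N` and an `(L^k·N)`-periodic `Y`:
   `Σ_{z∈periodBox N} ‖framePot L k Y z‖² ≤ 12·Dfp d L·Σ_{x∈periodBox (L^k·N)} Σ_κ ‖Y x κ‖²` (Sedrakyan `Finset.sq_sum_div_le_sum_sq_div` with weights `(3∕4)^m`,
   `(L²∕L^d)·(4∕3) ≤ 2∕3`, geometric sums `≤ 4` and `≤ 3`).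

HONEST: flat-lattice kinematics on OUR frame; constant crude (box counting) but k-FREE and N-FREE; nothing about minimisers, (P) on T_♮, (P_W), (ML_w), T-E_w or
NE3 is asserted; NE3 NOT proved; spine 0∕9; finite T⁴ rung (B)+1 — NOT infinite volume, NOT mass gap, NOT BetaPertH, NOT Clay.  PLACEMENT: `Summits/QuantumFields/BalabanUV/`.
-/

set_option autoImplicit false

open scoped BigOperators Matrix.Norms.L2Operator
open Finset

namespace Summit.QuantumFields.BalabanUV.T4Continuum.NE3FramePotBound

open Literature.MathematicalPhysics.QuantumFieldTheory.Balaban1983to89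
open B7Prop1Explicit B7Prop2Explicit B7Prop3Flat
open T4AveragingDeficitWall (IsUnitaryCfg dirL1 box)
open T4AveragingDeficitWallBoundary (periodBox card_periodBox)
open AveragingDeficitPeriodicCounting (IsPeriodicDir sum_periodBox_box_le)
open AveragingDeficitTransport (lnorm norm_dhol_le)
open AveragingDeficitPlaqLin (lnorm_le_region)
open BlockAveragePushDirSplit (flat dhol_flat sum_blockWeight_eq_one)
open NE3TangentFlatStructure (Qcoarse Fcoarse framePot framePot_succ framePot_zero iterate_Qcoarse_add_period)
open NE3BlockLineAverage (Qcoarse_apply)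
open NE3CovariantLineSumsL2 (l2sq l2sq_nonneg dirL1_box_sq_le sum_tile_shift)

noncomputable section

variable {d : ℕ} {n : Type*} [Fintype n] [DecidableEq n]

/-! ## §1 The closed form of the accumulated frame potential -/

/-- **CLOSED FORM**: `framePot L k Y z = Σ_{m<k} Fcoarse L ((Qcoarse L)^[m] Y) ((L^{k−1−m})•z)` — the level-`m` frames read at the corner of the big
block, at scale `L^{k−m}`. [folklore] -/
theorem framePot_eq_sum (L : ℕ) : ∀ (k : ℕ) (Y : Site d → Fin d → Matrix n n ℂ) (z : Site d),
    framePot L k Y z = ∑ m ∈ range k, Fcoarse L ((Qcoarse L)^[m] Y) (((L : ℤ) ^ (k - 1 - m)) • z)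
  | 0, Y, z => by simp
  | k + 1, Y, z => by
      rw [framePot_succ, framePot_eq_sum L k Y ((L : ℤ) • z), Finset.sum_range_succ, add_comm]
      congr 1
      · refine Finset.sum_congr rfl fun m hm => ?_
        have hmk : m < k := Finset.mem_range.mp hm
        rw [smul_smul, ← pow_succ, show k - 1 - m + 1 = k + 1 - 1 - m by omega]
      · rw [show k + 1 - 1 - k = 0 by omega, pow_zero, one_smul]

/-! ## §2 One term: block-tree averages, the straight average in ℓ², the torus bound -/

omit [DecidableEq n] in
/-- `1` is a unitary configuration. [folklore] -/
theorem isUnitaryCfg_flat [DecidableEq n] : IsUnitaryCfg (flat (d := d) (n := n)) := fun _ _ => (unitaryUnits (Matrix n n ℂ)).one_mem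

/-- **ONE BLOCK-TREE AVERAGE AGAINST THE BOX**: `‖Fcoarse L V y‖ ≤ dL·dirL1 V (box (dL) (L•y))` (every tree contour has at most `dL` bonds, all within
l¹-distance `dL` of the corner; the weights `L^{−d}` sum to one). [folklore] -/
theorem norm_Fcoarse_le {L : ℕ} (hL : 1 ≤ L) (V : Site d → Fin d → Matrix n n ℂ) (y : Site d) :
    ‖Fcoarse L V y‖ ≤ (d * L : ℝ) * dirL1 V (box (d * L) ((L : ℤ) • y)) := by
  have hwt := sum_blockWeight_eq_one (d := d) L hL
  have hD0 : 0 ≤ dirL1 V (box (d * L) ((L : ℤ) • y)) := by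
    unfold dirL1; exact Finset.sum_nonneg fun _ _ => Finset.sum_nonneg fun _ _ => norm_nonneg _
  show ‖Fhat L V ((L : ℤ) • y)‖ ≤ _
  unfold Fhat
  calc ‖∑ r : Fin d → Fin L, (((L : ℝ) ^ d)⁻¹) • asum V ((L : ℤ) • y) (treeWord (boxVec L r))‖
      ≤ ∑ r : Fin d → Fin L, ‖(((L : ℝ) ^ d)⁻¹) • asum V ((L : ℤ) • y) (treeWord (boxVec L r))‖ := norm_sum_le _ _
    _ ≤ ∑ _r : Fin d → Fin L, ((L : ℝ) ^ d)⁻¹ * ((d * L : ℝ) * dirL1 V (box (d * L) ((L : ℤ) • y))) := by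
        refine Finset.sum_le_sum fun r _ => ?_
        rw [norm_smul, Real.norm_eq_abs, abs_of_nonneg (by positivity)]
        refine mul_le_mul_of_nonneg_left ?_ (by positivity)
        rw [← dhol_flat]
        refine (norm_dhol_le isUnitaryCfg_flat V _ _).trans ?_
        have hlen : (treeWord (boxVec L r)).length ≤ d * L := by rw [length_treeWord]; exact l1_boxVec_le L r
        have h := lnorm_le_region V (z := (L : ℤ) • y) (q := (L : ℤ) • y) (R := d * L) (treeWord (boxVec L r))
          (by rw [sub_self]; simp only [l1, Pi.zero_apply, Int.natAbs_zero, Finset.sum_const_zero, zero_add]; exact hlen)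
        exact h.trans (mul_le_mul_of_nonneg_right (by exact_mod_cast hlen) hD0)
    _ = (d * L : ℝ) * dirL1 V (box (d * L) ((L : ℤ) • y)) := by rw [← Finset.sum_mul, hwt, one_mul]

/-- … squared, by Cauchy–Schwarz on the box: `‖Fcoarse L V y‖² ≤ (dL)²·(d·(2dL+1)^d)·Σ_{x∈box (dL) (L•y)} Σ_κ ‖V x κ‖²`. [folklore] -/
theorem norm_Fcoarse_sq_le {L : ℕ} (hL : 1 ≤ L) (V : Site d → Fin d → Matrix n n ℂ) (y : Site d) :
    ‖Fcoarse L V y‖ ^ 2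
      ≤ (d * L : ℝ) ^ 2 * ((d : ℝ) * ((2 * (d * L) + 1 : ℕ) : ℝ) ^ d * ∑ x ∈ box (d * L) ((L : ℤ) • y), ∑ κ : Fin d, ‖V x κ‖ ^ 2) := by
  have h1 := norm_Fcoarse_le (d := d) hL V y
  have h2 := dirL1_box_sq_le (d := d) V (d * L) ((L : ℤ) • y)
  have h0 : 0 ≤ ‖Fcoarse L V y‖ := norm_nonneg _
  calc ‖Fcoarse L V y‖ ^ 2 ≤ ((d * L : ℝ) * dirL1 V (box (d * L) ((L : ℤ) • y))) ^ 2 := pow_le_pow_left₀ h0 h1 2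
    _ = (d * L : ℝ) ^ 2 * dirL1 V (box (d * L) ((L : ℤ) • y)) ^ 2 := by ring
    _ ≤ _ := mul_le_mul_of_nonneg_left h2 (by positivity)

/-- **THE STRAIGHT AVERAGE IN ℓ²(TORUS), EXACT WEIGHT** (flat): for an `(L·P)`-periodic `Y`, `l2sq (periodBox P) (Qcoarse L Y) ≤ (L²∕L^d)·l2sq (periodBox (L·P)) Y`.
[folklore] -/
theorem l2sq_Qcoarse_le {L : ℕ} (hL : 1 ≤ L) {P : ℕ} (hP : 1 ≤ P) {Y : Site d → Fin d → Matrix n n ℂ}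
    (hY : IsPeriodicDir Y ((L * P : ℕ) : ℤ)) :
    l2sq (periodBox (d := d) P) (Qcoarse L Y) ≤ (L : ℝ) ^ 2 / (L : ℝ) ^ d * l2sq (periodBox (d := d) (L * P)) Y := by
  have hL0 : (0 : ℝ) < L := by exact_mod_cast (by omega : 0 < L)
  -- pointwise Cauchy–Schwarz
  have hpt : ∀ (y : Site d) (κ : Fin d), ‖Qcoarse L Y y κ‖ ^ 2
      ≤ (L : ℝ) / (L : ℝ) ^ d * ∑ v ∈ periodBox (d := d) L, ∑ i ∈ range L, ‖Y ((L : ℤ) • y + v + (i : ℤ) • e κ) κ‖ ^ 2 := by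
    intro y κ
    set T : Finset (Site d × ℕ) := periodBox (d := d) L ×ˢ range L with hT
    have hcardT : (T.card : ℝ) = (L : ℝ) ^ d * L := by
      rw [hT, Finset.card_product, card_periodBox, card_range]; push_cast; ring
    have h1 : ‖Qcoarse L Y y κ‖ ≤ ((L : ℝ) ^ d)⁻¹ * ∑ p ∈ T, ‖Y ((L : ℤ) • y + p.1 + (p.2 : ℤ) • e κ) κ‖ := by
      rw [Qcoarse_apply, norm_smul, Real.norm_eq_abs, abs_of_nonneg (by positivity), hT, Finset.sum_product]
      exact mul_le_mul_of_nonneg_left ((norm_sum_le _ _).trans (Finset.sum_le_sum fun v _ => norm_sum_le _ _)) (by positivity)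
    have hcs : (∑ p ∈ T, ‖Y ((L : ℤ) • y + p.1 + (p.2 : ℤ) • e κ) κ‖) ^ 2
        ≤ (T.card : ℝ) * ∑ p ∈ T, ‖Y ((L : ℤ) • y + p.1 + (p.2 : ℤ) • e κ) κ‖ ^ 2 := by
      exact_mod_cast sq_sum_le_card_mul_sum_sq (s := T) (f := fun p => ‖Y ((L : ℤ) • y + p.1 + (p.2 : ℤ) • e κ) κ‖)
    rw [hcardT] at hcs
    have hsum2 : ∑ p ∈ T, ‖Y ((L : ℤ) • y + p.1 + (p.2 : ℤ) • e κ) κ‖ ^ 2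
        = ∑ v ∈ periodBox (d := d) L, ∑ i ∈ range L, ‖Y ((L : ℤ) • y + v + (i : ℤ) • e κ) κ‖ ^ 2 := by rw [hT, Finset.sum_product]
    have h0 : 0 ≤ ‖Qcoarse L Y y κ‖ := norm_nonneg _
    calc ‖Qcoarse L Y y κ‖ ^ 2 ≤ (((L : ℝ) ^ d)⁻¹ * ∑ p ∈ T, ‖Y ((L : ℤ) • y + p.1 + (p.2 : ℤ) • e κ) κ‖) ^ 2 := pow_le_pow_left₀ h0 h1 2
      _ = (((L : ℝ) ^ d)⁻¹) ^ 2 * (∑ p ∈ T, ‖Y ((L : ℤ) • y + p.1 + (p.2 : ℤ) • e κ) κ‖) ^ 2 := by ring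
      _ ≤ (((L : ℝ) ^ d)⁻¹) ^ 2 * ((L : ℝ) ^ d * L * ∑ p ∈ T, ‖Y ((L : ℤ) • y + p.1 + (p.2 : ℤ) • e κ) κ‖ ^ 2) :=
          mul_le_mul_of_nonneg_left hcs (by positivity)
      _ = (L : ℝ) / (L : ℝ) ^ d * ∑ v ∈ periodBox (d := d) L, ∑ i ∈ range L, ‖Y ((L : ℤ) • y + v + (i : ℤ) • e κ) κ‖ ^ 2 := by
          rw [hsum2]; field_simp
  -- the tiling
  have htile : ∀ (κ : Fin d), ∑ y ∈ periodBox (d := d) P, ∑ v ∈ periodBox (d := d) L, ∑ i ∈ range L,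
      ‖Y ((L : ℤ) • y + v + (i : ℤ) • e κ) κ‖ ^ 2 = L * ∑ x ∈ periodBox (d := d) (L * P), ‖Y x κ‖ ^ 2 := by
    intro κ
    have hper : ∀ (x : Site d) (τ : Fin d), (fun x => ‖Y x κ‖ ^ 2) (x + ((L * P : ℕ) : ℤ) • e τ) = (fun x => ‖Y x κ‖ ^ 2) x := by
      intro x τ; simp only; rw [hY x τ κ]
    exact sum_tile_shift hL hP (fun x => ‖Y x κ‖ ^ 2) hper κ
  unfold l2sq
  set c : ℝ := (L : ℝ) / (L : ℝ) ^ d with hc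
  set inner : Site d → Fin d → ℝ := fun y κ =>
    ∑ v ∈ periodBox (d := d) L, ∑ i ∈ range L, ‖Y ((L : ℤ) • y + v + (i : ℤ) • e κ) κ‖ ^ 2 with hinner
  have step1 : ∑ y ∈ periodBox (d := d) P, ∑ κ : Fin d, ‖Qcoarse L Y y κ‖ ^ 2 ≤ ∑ y ∈ periodBox (d := d) P, ∑ κ : Fin d, c * inner y κ :=
    Finset.sum_le_sum fun y _ => Finset.sum_le_sum fun κ _ => hpt y κ
  have step2 : ∑ y ∈ periodBox (d := d) P, ∑ κ : Fin d, c * inner y κ = c * (L * ∑ x ∈ periodBox (d := d) (L * P), ∑ κ : Fin d, ‖Y x κ‖ ^ 2) := by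
    rw [Finset.sum_comm]
    simp only [← Finset.mul_sum]
    congr 1
    calc ∑ κ : Fin d, ∑ y ∈ periodBox (d := d) P, inner y κ
        = ∑ κ : Fin d, ((L : ℝ) * ∑ x ∈ periodBox (d := d) (L * P), ‖Y x κ‖ ^ 2) :=
          Finset.sum_congr rfl fun κ _ => by rw [hinner]; exact htile κ
      _ = (L : ℝ) * ∑ κ : Fin d, ∑ x ∈ periodBox (d := d) (L * P), ‖Y x κ‖ ^ 2 := by rw [Finset.mul_sum]
      _ = (L : ℝ) * ∑ x ∈ periodBox (d := d) (L * P), ∑ κ : Fin d, ‖Y x κ‖ ^ 2 := by rw [Finset.sum_comm]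
  have step3 : c * (L * ∑ x ∈ periodBox (d := d) (L * P), ∑ κ : Fin d, ‖Y x κ‖ ^ 2)
      = (L : ℝ) ^ 2 / (L : ℝ) ^ d * ∑ x ∈ periodBox (d := d) (L * P), ∑ κ : Fin d, ‖Y x κ‖ ^ 2 := by rw [hc]; ring
  linarith [step1, step2, step3]

/-- **THE m-FOLD STRAIGHT AVERAGE IN ℓ²(TORUS)**: `l2sq (periodBox P) ((Qcoarse L)^[m] Y) ≤ (L²∕L^d)^m·l2sq (periodBox (L^m·P)) Y` for an `(L^m·P)`-periodic `Y`.
[folklore] -/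
theorem l2sq_iterate_Qcoarse_le {L : ℕ} (hL : 1 ≤ L) : ∀ (m : ℕ) {P : ℕ}, 1 ≤ P → ∀ {Y : Site d → Fin d → Matrix n n ℂ},
    IsPeriodicDir Y ((L ^ m * P : ℕ) : ℤ) →
      l2sq (periodBox (d := d) P) ((Qcoarse L)^[m] Y) ≤ ((L : ℝ) ^ 2 / (L : ℝ) ^ d) ^ m * l2sq (periodBox (d := d) (L ^ m * P)) Y
  | 0, P, _, Y, _ => by simp
  | m + 1, P, hP, Y, hY => by
      rw [Function.iterate_succ_apply]
      have hLP : 1 ≤ L ^ m * P := Nat.one_le_iff_ne_zero.mpr (Nat.mul_ne_zero (pow_ne_zero _ (by omega)) (by omega))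
      -- `Qcoarse L Y` is `(L^m·P)`-periodic
      have hY' : ∀ (y : Site d) (τ μ : Fin d), Y (y + ((L : ℤ) * ((L ^ m * P : ℕ) : ℤ)) • e τ) μ = Y y μ := by
        intro y τ μ
        have e : (L : ℤ) * ((L ^ m * P : ℕ) : ℤ) = ((L ^ (m + 1) * P : ℕ) : ℤ) := by push_cast; ring
        rw [e]; exact hY y τ μ
      have hQP : IsPeriodicDir (Qcoarse L Y) ((L ^ m * P : ℕ) : ℤ) :=
        fun z τ κ => NE3TangentFlatStructure.Qcoarse_add_period L Y hY' z τ κ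
      have h1 := l2sq_iterate_Qcoarse_le hL m hP hQP
      have hY'' : IsPeriodicDir Y ((L * (L ^ m * P) : ℕ) : ℤ) := by
        have e : ((L * (L ^ m * P) : ℕ) : ℤ) = ((L ^ (m + 1) * P : ℕ) : ℤ) := by push_cast; ring
        rw [e]; exact hY
      have h2 := l2sq_Qcoarse_le (d := d) hL hLP hY''
      have hρ : 0 ≤ ((L : ℝ) ^ 2 / (L : ℝ) ^ d) ^ m := by positivity
      calc l2sq (periodBox (d := d) P) ((Qcoarse L)^[m] (Qcoarse L Y))
          ≤ ((L : ℝ) ^ 2 / (L : ℝ) ^ d) ^ m * l2sq (periodBox (d := d) (L ^ m * P)) (Qcoarse L Y) := h1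
        _ ≤ ((L : ℝ) ^ 2 / (L : ℝ) ^ d) ^ m * ((L : ℝ) ^ 2 / (L : ℝ) ^ d * l2sq (periodBox (d := d) (L * (L ^ m * P))) Y) :=
            mul_le_mul_of_nonneg_left h2 hρ
        _ = ((L : ℝ) ^ 2 / (L : ℝ) ^ d) ^ (m + 1) * l2sq (periodBox (d := d) (L ^ (m + 1) * P)) Y := by
            rw [show L * (L ^ m * P) = L ^ (m + 1) * P by ring]; ring

/-- The explicit (crude, box-counting) constant of one level: `Dfp d L = (dL)²·d·(2dL+1)^{2d}`. [folklore] -/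
def Dfp (d L : ℕ) : ℝ := (d * L : ℝ) ^ 2 * (d : ℝ) * ((2 * (d * L) + 1 : ℕ) : ℝ) ^ (2 * d)

/-- **ONE LEVEL ON THE TORUS**: for `j + 1 + m = k` and an `(L^k·N)`-periodic `Y`,
`Σ_{z∈periodBox N} ‖Fcoarse L ((Qcoarse L)^[m] Y) ((L^j)•z)‖² ≤ Dfp d L·(L²∕L^d)^m·l2sq (periodBox (L^k·N)) Y`. [folklore] -/
theorem sum_norm_Fcoarse_iterate_sq_le {L : ℕ} (hL : 1 ≤ L) {N : ℕ} (hN : 1 ≤ N) (j m : ℕ) {Y : Site d → Fin d → Matrix n n ℂ}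
    (hY : IsPeriodicDir Y ((L ^ (j + 1 + m) * N : ℕ) : ℤ)) :
    ∑ z ∈ periodBox (d := d) N, ‖Fcoarse L ((Qcoarse L)^[m] Y) (((L : ℤ) ^ j) • z)‖ ^ 2
      ≤ Dfp d L * ((L : ℝ) ^ 2 / (L : ℝ) ^ d) ^ m * l2sq (periodBox (d := d) (L ^ (j + 1 + m) * N)) Y := by
  set V : Site d → Fin d → Matrix n n ℂ := (Qcoarse L)^[m] Y with hV
  set R : ℕ := d * L with hR
  set g : Site d → ℝ := fun x => ∑ κ : Fin d, ‖V x κ‖ ^ 2 with hg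
  -- `V` is `(L^{j+1}·N)`-periodic
  have hVP : ∀ (x : Site d) (τ : Fin d), g (x + ((L ^ (j + 1) * N : ℕ) : ℤ) • e τ) = g x := by
    intro x τ
    have hYm : ∀ (y : Site d) (τ' μ : Fin d), Y (y + ((L : ℤ) ^ m * ((L ^ (j + 1) * N : ℕ) : ℤ)) • e τ') μ = Y y μ := by
      intro y τ' μ
      have e : (L : ℤ) ^ m * ((L ^ (j + 1) * N : ℕ) : ℤ) = ((L ^ (j + 1 + m) * N : ℕ) : ℤ) := by push_cast; ring
      rw [e]; exact hY y τ' μ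
    simp only [hg, hV]
    exact Finset.sum_congr rfl fun κ _ => by rw [iterate_Qcoarse_add_period L m Y hYm x τ κ]
  have hg0 : ∀ x, 0 ≤ g x := fun x => by rw [hg]; positivity
  -- pointwise, with the centre `L•(L^j•z) = (L^{j+1})•z`
  have hLj : 1 ≤ L ^ (j + 1) := Nat.one_le_pow _ _ hL
  have hpt : ∀ z : Site d, ‖Fcoarse L V (((L : ℤ) ^ j) • z)‖ ^ 2
      ≤ (d * L : ℝ) ^ 2 * ((d : ℝ) * ((2 * R + 1 : ℕ) : ℝ) ^ d * ∑ x ∈ box R (((L ^ (j + 1) : ℕ) : ℤ) • z), g x) := by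
    intro z
    have h := norm_Fcoarse_sq_le (d := d) hL V (((L : ℤ) ^ j) • z)
    have e : (L : ℤ) • (((L : ℤ) ^ j) • z) = (((L ^ (j + 1) : ℕ) : ℤ)) • z := by
      rw [smul_smul]; congr 1; push_cast; ring
    rw [e] at h
    simpa only [hR, hg] using h
  have hbox := sum_periodBox_box_le (L ^ (j + 1)) N hLj hN R hg0 hVP
  have hl2 := l2sq_iterate_Qcoarse_le (d := d) hL m (P := L ^ (j + 1) * N)
    (Nat.one_le_iff_ne_zero.mpr (Nat.mul_ne_zero (pow_ne_zero _ (by omega)) (by omega)))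
    (Y := Y) (by rw [show L ^ m * (L ^ (j + 1) * N) = L ^ (j + 1 + m) * N by ring]; exact hY)
  have hl2' : ∑ x ∈ periodBox (d := d) (L ^ (j + 1) * N), g x ≤ ((L : ℝ) ^ 2 / (L : ℝ) ^ d) ^ m * l2sq (periodBox (d := d) (L ^ (j + 1 + m) * N)) Y := by
    have e : ∑ x ∈ periodBox (d := d) (L ^ (j + 1) * N), g x = l2sq (periodBox (d := d) (L ^ (j + 1) * N)) V := by rw [hg]; rfl
    rw [e, hV, show L ^ (j + 1 + m) * N = L ^ m * (L ^ (j + 1) * N) by ring]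
    exact hl2
  have hD : (0 : ℝ) ≤ (d * L : ℝ) ^ 2 * ((d : ℝ) * ((2 * R + 1 : ℕ) : ℝ) ^ d) := by positivity
  calc ∑ z ∈ periodBox (d := d) N, ‖Fcoarse L V (((L : ℤ) ^ j) • z)‖ ^ 2
      ≤ ∑ z ∈ periodBox (d := d) N, (d * L : ℝ) ^ 2 * ((d : ℝ) * ((2 * R + 1 : ℕ) : ℝ) ^ d * ∑ x ∈ box R (((L ^ (j + 1) : ℕ) : ℤ) • z), g x) :=
        Finset.sum_le_sum fun z _ => hpt z
    _ = (d * L : ℝ) ^ 2 * ((d : ℝ) * ((2 * R + 1 : ℕ) : ℝ) ^ d) * ∑ z ∈ periodBox (d := d) N, ∑ x ∈ box R (((L ^ (j + 1) : ℕ) : ℤ) • z), g x := by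
        rw [Finset.mul_sum]; exact Finset.sum_congr rfl fun z _ => by ring
    _ ≤ (d * L : ℝ) ^ 2 * ((d : ℝ) * ((2 * R + 1 : ℕ) : ℝ) ^ d) * (((2 * R + 1 : ℕ) : ℝ) ^ d * ∑ x ∈ periodBox (d := d) (L ^ (j + 1) * N), g x) := by
        refine mul_le_mul_of_nonneg_left ?_ hD
        exact_mod_cast hbox
    _ ≤ (d * L : ℝ) ^ 2 * ((d : ℝ) * ((2 * R + 1 : ℕ) : ℝ) ^ d)
          * (((2 * R + 1 : ℕ) : ℝ) ^ d * (((L : ℝ) ^ 2 / (L : ℝ) ^ d) ^ m * l2sq (periodBox (d := d) (L ^ (j + 1 + m) * N)) Y)) :=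
        mul_le_mul_of_nonneg_left (mul_le_mul_of_nonneg_left hl2' (by positivity)) hD
    _ = Dfp d L * ((L : ℝ) ^ 2 / (L : ℝ) ^ d) ^ m * l2sq (periodBox (d := d) (L ^ (j + 1 + m) * N)) Y := by
        simp only [Dfp, hR]; ring

/-! ## §3 The k-free frame bound -/

omit [Fintype n] [DecidableEq n] in
/-- In `d ≥ 3`, `L ≥ 2`: `(L²∕L^d)·(4∕3) ≤ 2∕3` (i.e. `L^{2}·4 ≤ 2·L^d`). [folklore] -/
theorem ratio_le {L : ℕ} (hd : 3 ≤ d) (hL : 2 ≤ L) : (L : ℝ) ^ 2 / (L : ℝ) ^ d * (4 / 3) ≤ 2 / 3 := by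
  have hL2 : (2 : ℝ) ≤ L := by exact_mod_cast hL
  have hL0 : (0 : ℝ) < L := by linarith
  have hLd : (L : ℝ) ^ 2 * 2 ≤ (L : ℝ) ^ d := by
    obtain ⟨e, rfl⟩ : ∃ e, d = e + 3 := ⟨d - 3, by omega⟩
    have h1 : (1 : ℝ) ≤ (L : ℝ) ^ e := one_le_pow₀ (by linarith)
    calc (L : ℝ) ^ 2 * 2 ≤ (L : ℝ) ^ 2 * L := by nlinarith
      _ = (L : ℝ) ^ 3 * 1 := by ring
      _ ≤ (L : ℝ) ^ 3 * (L : ℝ) ^ e := mul_le_mul_of_nonneg_left h1 (by positivity)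
      _ = (L : ℝ) ^ (e + 3) := by ring
  have hpos : (0 : ℝ) < (L : ℝ) ^ d := by positivity
  rw [div_mul_eq_mul_div, div_le_div_iff₀ (by positivity) (by norm_num)]
  nlinarith

omit [Fintype n] [DecidableEq n] in
/-- Geometric sums: `Σ_{m<k} q^m ≤ 1∕(1−q)` for `0 ≤ q < 1`. [folklore] -/
theorem geom_sum_le_inv {q : ℝ} (hq0 : 0 ≤ q) (hq1 : q < 1) (k : ℕ) : ∑ m ∈ range k, q ^ m ≤ 1 / (1 - q) := by
  rw [geom_sum_eq (ne_of_lt hq1) k]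
  have h1 : 0 < 1 - q := by linarith
  have hqk : 0 ≤ q ^ k := pow_nonneg hq0 k
  have e : (q ^ k - 1) / (q - 1) = (1 - q ^ k) / (1 - q) := by
    rw [div_eq_div_iff (by linarith) (by linarith)]; ring
  rw [e]
  exact div_le_div_of_nonneg_right (by linarith) h1.le

/-- **THE CRUDE FRAME BOUND (Φ2′c)**: for `3 ≤ d`, `2 ≤ L`, `1 ≤ N` and an `(L^k·N)`-periodic `Y`,
`Σ_{z∈periodBox N} ‖framePot L k Y z‖² ≤ 12·Dfp d L·Σ_{x∈periodBox (L^k·N)} Σ_κ ‖Y x κ‖²` — k-FREE, N-FREE («corner spikes are cheap»: the level-`m`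
term carries the weight `(L²∕L^d)^m ≤ 2^{−m}`; weighted Cauchy–Schwarz with weights `(3∕4)^m`). [folklore] -/
theorem sum_norm_framePot_sq_le (hd : 3 ≤ d) {L : ℕ} (hL : 2 ≤ L) {N : ℕ} (hN : 1 ≤ N) (k : ℕ) {Y : Site d → Fin d → Matrix n n ℂ}
    (hY : IsPeriodicDir Y ((L ^ k * N : ℕ) : ℤ)) :
    ∑ z ∈ periodBox (d := d) N, ‖framePot L k Y z‖ ^ 2 ≤ 12 * Dfp d L * l2sq (periodBox (d := d) (L ^ k * N)) Y := by
  have hL1 : 1 ≤ L := by omega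
  have hD0 : 0 ≤ Dfp d L := by unfold Dfp; positivity
  have hS0 : 0 ≤ l2sq (periodBox (d := d) (L ^ k * N)) Y := l2sq_nonneg _ _
  rcases Nat.eq_zero_or_pos k with hk | hk
  · subst hk
    have h0 : 0 ≤ 12 * Dfp d L * l2sq (periodBox (d := d) (L ^ 0 * N)) Y := mul_nonneg (mul_nonneg (by norm_num) hD0) hS0
    simpa using h0
  -- notation: the terms `a m z` and the weights `w m = (3/4)^m`
  set ρ2 : ℝ := (L : ℝ) ^ 2 / (L : ℝ) ^ d with hρ2
  have hρ0 : 0 ≤ ρ2 := by rw [hρ2]; positivity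
  have hρq : ρ2 * (4 / 3) ≤ 2 / 3 := ratio_le (d := d) hd hL
  set a : ℕ → Site d → ℝ := fun m z => ‖Fcoarse L ((Qcoarse L)^[m] Y) (((L : ℤ) ^ (k - 1 - m)) • z)‖ with ha
  set w : ℕ → ℝ := fun m => (3 / 4 : ℝ) ^ m with hw
  have hwpos : ∀ m ∈ range k, 0 < w m := fun m _ => by rw [hw]; positivity
  have hwsum : ∑ m ∈ range k, w m ≤ 4 := by
    have := geom_sum_le_inv (q := (3 / 4 : ℝ)) (by norm_num) (by norm_num) k
    simpa [hw] using this.trans (by norm_num)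
  have hwsum0 : 0 < ∑ m ∈ range k, w m := Finset.sum_pos hwpos ⟨0, Finset.mem_range.mpr hk⟩
  -- (1) pointwise: `‖framePot‖ ≤ Σ_m a m z` and Sedrakyan
  have hpt : ∀ z : Site d, ‖framePot L k Y z‖ ^ 2 ≤ 4 * ∑ m ∈ range k, a m z ^ 2 / w m := by
    intro z
    have h1 : ‖framePot L k Y z‖ ≤ ∑ m ∈ range k, a m z := by
      rw [framePot_eq_sum]; exact norm_sum_le _ _
    have h2 := Finset.sq_sum_div_le_sum_sq_div (range k) (fun m => a m z) hwpos
    have h3 : (∑ m ∈ range k, a m z) ^ 2 ≤ (∑ m ∈ range k, w m) * ∑ m ∈ range k, a m z ^ 2 / w m := by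
      rw [div_le_iff₀ hwsum0] at h2; linarith [h2]
    have h4 : 0 ≤ ∑ m ∈ range k, a m z ^ 2 / w m :=
      Finset.sum_nonneg fun m hm => div_nonneg (sq_nonneg _) (hwpos m hm).le
    have h0 : 0 ≤ ‖framePot L k Y z‖ := norm_nonneg _
    calc ‖framePot L k Y z‖ ^ 2 ≤ (∑ m ∈ range k, a m z) ^ 2 := pow_le_pow_left₀ h0 h1 2
      _ ≤ (∑ m ∈ range k, w m) * ∑ m ∈ range k, a m z ^ 2 / w m := h3
      _ ≤ 4 * ∑ m ∈ range k, a m z ^ 2 / w m := mul_le_mul_of_nonneg_right hwsum h4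
  -- (2) the torus sum of each weighted term
  have hterm : ∀ m ∈ range k, ∑ z ∈ periodBox (d := d) N, a m z ^ 2 / w m
      ≤ Dfp d L * (2 / 3 : ℝ) ^ m * l2sq (periodBox (d := d) (L ^ k * N)) Y := by
    intro m hm
    have hmk : m < k := Finset.mem_range.mp hm
    have hjm : k - 1 - m + 1 + m = k := by omega
    have hY' : IsPeriodicDir Y ((L ^ (k - 1 - m + 1 + m) * N : ℕ) : ℤ) := by rw [hjm]; exact hY
    have h := sum_norm_Fcoarse_iterate_sq_le (d := d) hL1 hN (k - 1 - m) m hY'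
    rw [hjm] at h
    rw [← Finset.sum_div]
    have hw' : w m = (3 / 4 : ℝ) ^ m := rfl
    rw [div_le_iff₀ (hwpos m hm), hw']
    calc ∑ z ∈ periodBox (d := d) N, a m z ^ 2 ≤ Dfp d L * ρ2 ^ m * l2sq (periodBox (d := d) (L ^ k * N)) Y := h
      _ ≤ Dfp d L * ((2 / 3 : ℝ) ^ m * (3 / 4 : ℝ) ^ m)⁻¹⁻¹ * l2sq (periodBox (d := d) (L ^ k * N)) Y := by
          rw [inv_inv]
          refine mul_le_mul_of_nonneg_right (mul_le_mul_of_nonneg_left ?_ hD0) hS0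
          rw [← mul_pow]
          exact pow_le_pow_left₀ hρ0 (by nlinarith) m
      _ = Dfp d L * (2 / 3 : ℝ) ^ m * l2sq (periodBox (d := d) (L ^ k * N)) Y * (3 / 4 : ℝ) ^ m := by rw [inv_inv]; ring
  -- (3) assemble
  have hgeo : ∑ m ∈ range k, (2 / 3 : ℝ) ^ m ≤ 3 := by
    have := geom_sum_le_inv (q := (2 / 3 : ℝ)) (by norm_num) (by norm_num) k
    exact this.trans (by norm_num)
  calc ∑ z ∈ periodBox (d := d) N, ‖framePot L k Y z‖ ^ 2
      ≤ ∑ z ∈ periodBox (d := d) N, 4 * ∑ m ∈ range k, a m z ^ 2 / w m := Finset.sum_le_sum fun z _ => hpt z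
    _ = 4 * ∑ m ∈ range k, ∑ z ∈ periodBox (d := d) N, a m z ^ 2 / w m := by rw [← Finset.mul_sum, Finset.sum_comm]
    _ ≤ 4 * ∑ m ∈ range k, Dfp d L * (2 / 3 : ℝ) ^ m * l2sq (periodBox (d := d) (L ^ k * N)) Y :=
        mul_le_mul_of_nonneg_left (Finset.sum_le_sum hterm) (by norm_num)
    _ = 4 * (Dfp d L * l2sq (periodBox (d := d) (L ^ k * N)) Y) * ∑ m ∈ range k, (2 / 3 : ℝ) ^ m := by
        simp only [Finset.mul_sum]; exact Finset.sum_congr rfl fun m _ => by ring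
    _ ≤ 4 * (Dfp d L * l2sq (periodBox (d := d) (L ^ k * N)) Y) * 3 :=
        mul_le_mul_of_nonneg_left hgeo (by positivity)
    _ = 12 * Dfp d L * l2sq (periodBox (d := d) (L ^ k * N)) Y := by ring

end

end Summit.QuantumFields.BalabanUV.T4Continuum.NE3FramePotBound
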